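import Summits.NavierStokesRegularity.NavierStokesRegularity.Theses.CorkscrewDynamo
import Literature.Analysis.FluidPDE.ClassicalSolutionGlue
import Literature.Analysis.FluidPDE.MildSolutionProofs

/-!
# Route CorkscrewDynamo · `ClassicalCorkscrewSuffices` (stmt-NavierStokesRegularity-11285)

The landing pad of route `CorkscrewDynamo`: a CLASSICAL Navier–Stokes solution `(u, p)` (`ν = 1`,
`f = 0`) on the time set `(-∞, 0)`, rotated `λ`-DSS about `e₃`, Type-I bounded, with pressure
bounded on every past slab `(-∞, t]`, `t < 0`, and NOT plainly `λ`-DSS at some point of the past,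
is a `CorkscrewProfile` witness (same `c`, `θ`, `R`, `u`).

Proof (folklore bookkeeping over proved tree facts):

* ancient mild: for `s < t < 0` translate time by `s`
  (`IsClassicalNSSolutionOn.comp_add_right`); the translate is classical on
  `(· + s)⁻¹' (-∞, 0) ⊇ [0, t - s]` with `u` (Type I ⇒ `|u| ≤ C₀/√(-t)` on `(-∞, t]`), `p`
  (hypothesis) and `f = 0` bounded, so Fabes–Jones–Rivière
  (`IsClassicalNSSolutionOn.isMildNSSolutionOn_holds`, PROVED in the tree) gives the duality
  identity between `0` and `t - s`; translate back with `IsMildNSSolutionBetween.comp_add_right`.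
  Weak divergence-freeness of the slices is `VectorCalculus.IsDivFree.isWeaklyDivFree_holds`;
* slices are continuous, hence `AEStronglyMeasurable`;
* two continuous functions that agree a.e. for Lebesgue measure agree everywhere
  (`Measure.eq_of_ae_eq`): pointwise failure of plain DSS at `(t₀, x₀)` therefore refutes
  `nsRescale c u t₀ =ᵐ u t₀`, and if every past slice vanished a.e. then `u ≡ 0` on the past and
  both sides of the failing identity at `(t₀, x₀)` would be `0`.
-/

namespace Summit.NavierStokesRegularity.NavierStokesRegularity.Theorems

open MeasureTheory Set Literature.Analysis.FluidPDE

/-- **Classical solutions on the past are ancient mild solutions.** If `(u, p)` is a classical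
Navier–Stokes solution (viscosity `ν > 0`, no force) on the time set `(-∞, 0)` with `u` and `p`
bounded on every past slab `(-∞, t]`, `t < 0`, then `u` is an ancient mild solution
(`IsAncientMildSolution ν u`): slices are classically hence weakly divergence free
(`VectorCalculus.IsDivFree.isWeaklyDivFree_holds`), and for `s < t < 0` the time-translate by
`s` is a bounded classical solution on `[0, t - s]`, hence mild there (Fabes–Jones–Rivière 1972,
Thm. 2.1 (i), tree: `IsClassicalNSSolutionOn.isMildNSSolutionOn_holds`); translating the
two-time identity back (`IsMildNSSolutionBetween.comp_add_right`) gives it between `s` and `t`.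
Helper for `ClassicalCorkscrewSuffices`. -/
theorem isAncientMildSolution_of_classical_Iio {E : Type*} [NormedAddCommGroup E]
    [InnerProductSpace ℝ E] [FiniteDimensional ℝ E] [MeasurableSpace E] [BorelSpace E]
    {ν : ℝ} (hν : 0 < ν) {u : ℝ → E → E} {p : ℝ → E → ℝ}
    (hcl : IsClassicalNSSolutionOn (Iio 0) ν 0 u p)
    (hu : ∀ t < 0, IsBoundedOn (Iic t) u) (hp : ∀ t < 0, IsBoundedOn (Iic t) p) :
    IsAncientMildSolution ν u := by
  refine ⟨fun t ht => ?_, fun s t hst ht => ?_⟩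
  · exact VectorCalculus.IsDivFree.isWeaklyDivFree_holds (hcl.divFree t ht)
      (contDiff_infty.1 (hcl.contDiff_velocity ht) 1)
  · -- the time-translate by `s` is classical on `(· + s)⁻¹' (-∞, 0) ⊇ [0, t - s]`
    have hE : IsClassicalNSSolutionOn ((· + s) ⁻¹' Iio 0) ν (fun τ => (0 : ℝ → E → E) (τ + s))
        (fun τ => u (τ + s)) (fun τ => p (τ + s)) := hcl.comp_add_right s
    have hshift : ∀ {τ : ℝ}, τ ∈ Icc 0 (t - s) → τ + s ≤ t := fun hτ => by linarith [hτ.2]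
    have hIcc : Icc 0 (t - s) ⊆ (· + s) ⁻¹' Iio (0 : ℝ) := fun τ hτ => by
      show τ + s < 0
      linarith [hshift hτ]
    obtain ⟨Mu, hMu⟩ := hu t ht
    obtain ⟨Mp, hMp⟩ := hp t ht
    have hbu : IsBoundedOn (Icc 0 (t - s)) (fun τ => u (τ + s)) :=
      ⟨Mu, fun τ hτ x => hMu (τ + s) (hshift hτ) x⟩
    have hbp : IsBoundedOn (Icc 0 (t - s)) (fun τ => p (τ + s)) :=
      ⟨Mp, fun τ hτ x => hMp (τ + s) (hshift hτ) x⟩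
    have hbf : IsBoundedOn (Icc 0 (t - s)) (fun τ => (0 : ℝ → E → E) (τ + s)) :=
      ⟨0, fun τ _ x => by simp⟩
    -- Fabes–Jones–Rivière on `[0, t - s]`
    have hmild : IsMildNSSolutionOn (Icc 0 (t - s)) ν (fun τ => (0 : ℝ → E → E) (τ + s))
        ((fun τ => u (τ + s)) 0) (fun τ => u (τ + s)) :=
      IsClassicalNSSolutionOn.isMildNSSolutionOn_holds (T := t - s) hE hν hIcc hbu hbp hbf
    have key : IsMildNSSolutionBetween ν (fun τ => (0 : ℝ → E → E) (τ + s)) (fun τ => u (τ + s))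
        (s + -s) (t + -s) := by
      rw [add_neg_cancel, ← sub_eq_add_neg]
      exact isMildNSSolutionFrom_self_iff.1 (hmild.2 (t - s) ⟨by linarith, le_rfl⟩)
    -- translate back by `-s`
    have h3 := key.comp_add_right
    have hu_eq : (fun τ => u (τ + -s + s)) = u := funext fun τ => by rw [neg_add_cancel_right]
    have hf_eq : (fun τ => (0 : ℝ → E → E) (τ + -s + s)) = 0 := funext fun τ => by simp
    rwa [hu_eq, hf_eq] at h3

/-- A Type-I bounded field is bounded on every past slab `(-∞, t]`, `t < 0`
(`‖u‖ ≤ C₀ / √(-t/2)` there; KNSS 2009, (1.4)/(1.6)). Helper for `ClassicalCorkscrewSuffices`. -/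
theorem isBoundedOn_Iic_of_hasTypeIDecay {E F : Type*} [NormedAddCommGroup E]
    [NormedAddCommGroup F] {C₀ : ℝ} {u : ℝ → E → F} (h : HasTypeIDecay C₀ u) {t : ℝ}
    (ht : t < 0) : IsBoundedOn (Iic t) u := by
  have hC₀ : 0 ≤ C₀ := by
    have h1 := (norm_nonneg _).trans (h (-1) (by norm_num) 0)
    simpa using h1
  exact ((h.hasTypeITimeDecay hC₀).isBoundedOn hC₀ (by linarith : 0 < -t / 2)).mono
    fun t' ht' => by
      simp only [mem_Iic, mem_Iio] at ht' ⊢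
      linarith

/-- **`ClassicalCorkscrewSuffices`** (route CorkscrewDynamo, stmt-NavierStokesRegularity-11285,
support / landing pad). If `(u, p)` is a classical Navier–Stokes solution (`ν = 1`, `f = 0`) on the
time set `(-∞, 0)`, rotated `λ`-DSS about `e₃` (`IsRotatedDSS c R u`, `R` the `θ`-rotation pinned
by coordinates, `λ = c > 1`), Type I (`HasTypeIDecay C₀ u`), with pressure bounded on every past
slab `(-∞, t]`, `t < 0`, and not plainly `λ`-DSS at some point `(t₀, x₀)` of the past, then the
`CorkscrewProfile` witness exists with the same `c`, `θ`, `R`, `u`: `u` is ancient mild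
(`isAncientMildSolution_of_classical_Iio`, Type I giving boundedness of `u` on past slabs), its
slices are continuous hence a.e.-strongly measurable, and by `Measure.eq_of_ae_eq` (continuous
functions a.e. equal for Lebesgue measure are equal) the pointwise failure of plain DSS at
`(t₀, x₀)` forbids both `nsRescale c u t₀ =ᵐ u t₀` and `u ≡ᵐ 0` on the past (else both sides of
the failing identity vanish). -/
theorem classicalCorkscrewSuffices_proof :
    Summit.NavierStokesRegularity.NavierStokesRegularity.Theses.CorkscrewDynamo.ClassicalCorkscrewSuffices := by
  unfold Summit.NavierStokesRegularity.NavierStokesRegularity.Theses.CorkscrewDynamo.ClassicalCorkscrewSuffices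
  rintro ⟨c, θ, C₀, R, u, p, hc, hR, hcl, hrdss, hTI, hp, t₀, ht₀, x₀, hne⟩
  have hc0 : 0 < c := one_pos.trans hc
  have hbd : ∀ t < 0, IsBoundedOn (Iic t) u := fun t ht => isBoundedOn_Iic_of_hasTypeIDecay hTI ht
  have hcont : ∀ t < 0, Continuous (u t) := fun t ht => (hcl.contDiff_velocity ht).continuous
  have hct₀ : c ^ 2 * t₀ < 0 := mul_neg_of_pos_of_neg (by positivity) ht₀
  refine ⟨c, θ, R, u, hc, hR, isAncientMildSolution_of_classical_Iio one_pos hcl hbd hp,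
    fun t ht => (hcont t ht).aestronglyMeasurable, hrdss, ⟨C₀, hTI⟩, ?_, ?_⟩
  · -- rotation essential: plain DSS fails on a set of positive measure at time `t₀`
    intro h
    have h1 : Continuous (nsRescale c u t₀) := by
      show Continuous fun x => c • u (c ^ 2 * t₀) (c • x)
      exact ((hcont _ hct₀).comp (continuous_const_smul c)).const_smul c
    exact hne (congr_fun (Measure.eq_of_ae_eq (h t₀ ht₀) h1 (hcont t₀ ht₀)) x₀)
  · -- nontriviality on the past
    intro h
    have hzero : ∀ t < 0, u t = 0 := fun t ht =>
      Measure.eq_of_ae_eq (h t ht) (hcont t ht) continuous_zero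
    apply hne
    rw [nsRescale_apply, hzero _ hct₀, hzero _ ht₀]
    simp

end Summit.NavierStokesRegularity.NavierStokesRegularity.Theorems
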